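import Summits.CriticalPhenomena.PercolationContinuityZ3.Theorems.PercBurnResprinkleUniformDiminishmentLocalModification

/-!
# Uniform diminishment on `ℤ³` (7/8): `AGLine.LocMod` with uniform constants; probabilities

Helper file for item `stmt-CriticalPhenomena-7206` (`PercBurnResprinkle.UniformDiminishment`, the quenched,
uniform Aizenman–Grimmett diminishment on `ℤ³`), landed with `--supports stmt-CriticalPhenomena-7206`.
The proof runs the in-tree Aizenman–Grimmett engine (`Literature.Probability.Percolation.AGLine`, after
Martineau–Severo 2019 §6) for the two-parameter model "edges open with probability `p`, points of the
thinned deleted set restored with probability `s`"; no definitions are introduced — the available-edge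
map `av` and the exit event `A` enter through characterising hypotheses (`hav`, `hA`).

Contents: the local modification property `AGLine.LocMod` of the exit event on its window, with
modification windows and cardinality bounds depending on `h, R` only (`locMod_event`, `card_CE_le`,
`card_CV_le`, `card_filter_mem_CV_le`); the identification `Θ(p,s) = ℙ_{p,s}(A)`
(`theta_eq_enhMeasure_real`, cylinder formula); the lower comparison
`P_p(deleted cluster of o infinite) ≤ ℙ_{p,s}(A)` and the upper comparison `ℙ_{p,s}(A) ≤ P_p(C(o) leaves
o + box r)` through the edge marginal; and the limit along increasing radii when `θ_o(p) = 0`.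
-/

namespace Summit.CriticalPhenomena.PercolationContinuityZ3.Theorems

open Literature.Probability.Percolation Literature.Probability.LatticeModels

namespace UnifDim

/-! ### The local modification property `AGLine.LocMod` on the window, with uniform constants -/

section LocMod

variable {D : Set (Site 3)} {av : Set (Sym2 (Site 3) ⊕ Site 3) → Set (Sym2 (Site 3))}
  {A : Set (Set (Sym2 (Site 3) ⊕ Site 3))} {o : Site 3} {r : ℕ}

/-- `|edges of ℤ³ meeting H| ≤ 6 |H|`. -/
theorem card_edgesTouching_zd3_le (H : Finset (Site 3)) :
    (edgesTouching (zdGraph 3) H).card ≤ 6 * H.card := by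
  classical
  calc (edgesTouching (zdGraph 3) H).card
      ≤ ∑ x ∈ H, ((zdGraph 3).incidenceFinset x).card := by
        rw [edgesTouching]; exact Finset.card_biUnion_le
    _ = ∑ _x ∈ H, 2 * 3 := Finset.sum_congr rfl fun x _ => by
        rw [SimpleGraph.card_incidenceFinset_eq_degree, ← SimpleGraph.card_neighborFinset_eq_degree]
        convert card_neighborFinset_zdGraph_holds (d := 3) x
    _ = 6 * H.card := by rw [Finset.sum_const, smul_eq_mul, mul_comm]

/-- The translated box `c + box n` has `(2n+1)³` points. -/
theorem card_image_add_box (c : Site 3) (n : ℕ) : ((box 3 n).image (· + c)).card = (2 * n + 1) ^ 3 := by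
  rw [Finset.card_image_of_injective _ (add_left_injective c), card_box]

/-- **`AGLine.LocMod` for the exit event** on the window `K = E(o + box(r+1)) ⊔ (o + box(r+1))`:
modification windows `CE e` = lattice edges meeting the `2(h+R+1)`-boxes around the endpoints of `e`,
`CV e` = the `(h+R)`-boxes around the endpoints of `e`. -/
theorem locMod_event
    (hav : ∀ ξ f, f ∈ av ξ ↔ Sum.inl f ∈ ξ ∧ f ∈ (zdGraph 3).edgeSet ∧ ∀ y ∈ f, y ∈ D → Sum.inr y ∈ ξ)
    (hA : ∀ ξ, ξ ∈ A ↔ ∃ v, (openGraph (av ξ)).Reachable o v ∧ v - o ∉ box 3 r)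
    {dsel : Site 3 → Site 3} {R h L : ℕ} (hD : ∀ y, y ∈ D ↔ ∃ j, dsel j = y)
    (hnear : ∀ j i, -(R : ℤ) ≤ dsel j i - o i - (2 * h + 1) * j i ∧ dsel j i - o i - (2 * h + 1) * j i ≤ R)
    (hh : 3 * R < h) (hr : r = L * (2 * h + 1) + h) (hL : 1 ≤ L) :
    AGLine.LocMod (edgesIn (zdGraph 3) ((box 3 (r + 1)).image (· + o))) ((box 3 (r + 1)).image (· + o)) A
      (fun e => edgesTouching (zdGraph 3)
        (((box 3 (2 * (h + R + 1))).image (· + (EnhProp42.ends e).1)) ∪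
          ((box 3 (2 * (h + R + 1))).image (· + (EnhProp42.ends e).2))))
      (fun e => ((box 3 (h + R)).image (· + (EnhProp42.ends e).1)) ∪
        ((box 3 (h + R)).image (· + (EnhProp42.ends e).2))) := by
  classical
  intro e he S hSK hpiv
  set KV : Finset (Site 3) := (box 3 (r + 1)).image (· + o) with hKV
  set KE : Finset (Sym2 (Site 3)) := edgesIn (zdGraph 3) KV with hKE
  have heE : e ∈ (zdGraph 3).edgeSet := (mem_edgesIn_iff.1 he).1
  have hdet := determinedBy_event hav hA
  obtain ⟨ξ', z, hoff, hmarks, hnear', hzpiv⟩ :=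
    exists_local_modification hav hA hD hnear hh hr hL heE hpiv
  set K : Finset (Sym2 (Site 3) ⊕ Site 3) := AGLine.K KE KV with hKdef
  have hKdef' : (↑K : Set (Sym2 (Site 3) ⊕ Site 3)) = ↑(KE.disjSum KV) := rfl
  set S' : Finset (Sym2 (Site 3) ⊕ Site 3) := K.filter fun i => i ∈ ξ' with hS'
  have hS'mem : ∀ i, i ∈ S' ↔ i ∈ K ∧ i ∈ ξ' := fun i => by rw [hS', Finset.mem_filter]
  have hS'coe : (↑S' : Set (Sym2 (Site 3) ⊕ Site 3)) ∩ ↑K = ξ' ∩ ↑K := by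
    ext i
    simp only [Set.mem_inter_iff, Finset.mem_coe, hS'mem]
    tauto
  -- agreement of `S` and `S'` off the windows
  have hagreeE : ∀ f : Sym2 (Site 3), f ∉ edgesTouching (zdGraph 3)
      (((box 3 (2 * (h + R + 1))).image (· + (EnhProp42.ends e).1)) ∪
        ((box 3 (2 * (h + R + 1))).image (· + (EnhProp42.ends e).2))) →
      ((Sum.inl f : Sym2 (Site 3) ⊕ Site 3) ∈ S ↔ (Sum.inl f : Sym2 (Site 3) ⊕ Site 3) ∈ S') := by
    intro f hf
    rw [hS'mem]
    by_cases hfK : (Sum.inl f : Sym2 (Site 3) ⊕ Site 3) ∈ K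
    · have hfE : f ∈ (zdGraph 3).edgeSet := by
        rw [hKdef, AGLine.inl_mem_K, hKE, mem_edgesIn_iff] at hfK
        exact hfK.1
      have hfar : ∀ x ∈ e, ∀ y ∈ f, y - x ∉ box 3 (2 * (h + R + 1)) := by
        intro x hx y hy hyx
        refine hf (mem_edgesTouching_iff.2 ⟨hfE, y, ?_, hy⟩)
        rw [Finset.mem_union, mem_image_add_box, mem_image_add_box]
        rcases EnhProp42.mem_iff_out.1 hx with rfl | rfl
        · exact Or.inl hyx
        · exact Or.inr hyx
      rw [hoff f hfar]
      exact ⟨fun h => ⟨hfK, h⟩, fun h => h.2⟩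
    · constructor
      · intro h; exact absurd (hSK h) hfK
      · intro h; exact absurd h.1 hfK
  refine ⟨S', fun i hi => ((hS'mem i).1 hi).1, ?_, ?_, hagreeE, ?_⟩
  · -- the pivotal mark
    have hzpiv' : IsPivotal A (Sum.inr z) (↑S' : Set (Sym2 (Site 3) ⊕ Site 3)) :=
      (EnhProp42.isPivotal_iff_of_determinedBy hdet _ hS'coe).2 hzpiv
    have hzK : (Sum.inr z : Sym2 (Site 3) ⊕ Site 3) ∈ (↑K : Set (Sym2 (Site 3) ⊕ Site 3)) :=
      EnhProp42.mem_of_isPivotal hdet (isUpperSet_event hav hA) hzpiv'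
    rw [Finset.mem_coe, hKdef, AGLine.inr_mem_K] at hzK
    refine ⟨z, hzK, ?_, hzpiv'⟩
    obtain ⟨x, hx, hzx⟩ := hnear'
    rw [Finset.mem_union, mem_image_add_box, mem_image_add_box]
    rcases EnhProp42.mem_iff_out.1 hx with rfl | rfl
    · exact Or.inl hzx
    · exact Or.inr hzx
  · -- agreement off `CE ⊔ CV`
    intro i hi
    cases i with
    | inl f => exact hagreeE f fun h => hi (Finset.inl_mem_disjSum.2 h)
    | inr y =>
      rw [hS'mem, hmarks]
      constructor
      · intro h; exact ⟨hSK h, h⟩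
      · intro h; exact h.2
  · -- marks untouched
    intro y hy
    exact (hmarks y).1 ((hS'mem _).1 hy).2

/-- `|CE e| ≤ 12 (4(h+R+1)+1)³`. -/
theorem card_CE_le (h R : ℕ) (e : Sym2 (Site 3)) :
    (edgesTouching (zdGraph 3)
        (((box 3 (2 * (h + R + 1))).image (· + (EnhProp42.ends e).1)) ∪
          ((box 3 (2 * (h + R + 1))).image (· + (EnhProp42.ends e).2)))).card ≤
      12 * (2 * (2 * (h + R + 1)) + 1) ^ 3 := by
  refine (card_edgesTouching_zd3_le _).trans ?_
  have := Finset.card_union_le ((box 3 (2 * (h + R + 1))).image (· + (EnhProp42.ends e).1))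
    ((box 3 (2 * (h + R + 1))).image (· + (EnhProp42.ends e).2))
  rw [card_image_add_box, card_image_add_box] at this
  omega

/-- `|CV e| ≤ 2 (2(h+R)+1)³`. -/
theorem card_CV_le (h R : ℕ) (e : Sym2 (Site 3)) :
    (((box 3 (h + R)).image (· + (EnhProp42.ends e).1)) ∪
        ((box 3 (h + R)).image (· + (EnhProp42.ends e).2))).card ≤ 2 * (2 * (h + R) + 1) ^ 3 := by
  have := Finset.card_union_le ((box 3 (h + R)).image (· + (EnhProp42.ends e).1))
    ((box 3 (h + R)).image (· + (EnhProp42.ends e).2))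
  rw [card_image_add_box, card_image_add_box] at this
  omega

/-- **Overlap**: the edges `e` of `ℤ³` with `y ∈ CV e` meet the `(h+R)`-box around `y`, so there are at
most `6 (2(h+R)+1)³` of them in any finset of lattice edges. -/
theorem card_filter_mem_CV_le (h R : ℕ) {KE : Finset (Sym2 (Site 3))}
    (hKE : ∀ e ∈ KE, e ∈ (zdGraph 3).edgeSet) (y : Site 3)
    {hdec : DecidablePred fun e : Sym2 (Site 3) => y ∈ ((box 3 (h + R)).image (· + (EnhProp42.ends e).1)) ∪
        ((box 3 (h + R)).image (· + (EnhProp42.ends e).2))} :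
    (KE.filter fun e => y ∈ ((box 3 (h + R)).image (· + (EnhProp42.ends e).1)) ∪
        ((box 3 (h + R)).image (· + (EnhProp42.ends e).2))).card ≤ 6 * (2 * (h + R) + 1) ^ 3 := by
  classical
  refine le_trans (Finset.card_le_card fun e he => ?_)
    ((card_edgesTouching_zd3_le ((box 3 (h + R)).image (· + y))).trans
      (by rw [card_image_add_box]))
  rw [Finset.mem_filter] at he
  obtain ⟨heK, hy⟩ := he
  rw [mem_edgesTouching_iff]
  refine ⟨hKE e heK, ?_⟩
  rw [Finset.mem_union, mem_image_add_box, mem_image_add_box] at hy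
  rcases hy with hy | hy
  · exact ⟨_, mem_image_add_box.2 (sub_mem_box_comm hy), EnhProp42.mem_iff_out.2 (Or.inl rfl)⟩
  · exact ⟨_, mem_image_add_box.2 (sub_mem_box_comm hy), EnhProp42.mem_iff_out.2 (Or.inr rfl)⟩


end LocMod

/-! ### Probabilities: the polynomial `Θ_L`, the two comparisons, and the limit `L → ∞` -/

section Measure

open MeasureTheory ProbabilityTheory
open scoped ENNReal

variable {D : Set (Site 3)} {av : Set (Sym2 (Site 3) ⊕ Site 3) → Set (Sym2 (Site 3))}
  {A : Set (Set (Sym2 (Site 3) ⊕ Site 3))} {o : Site 3} {r : ℕ}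

/-- **`Θ(p, s) = ℙ_{p,s}(A)`** for an event determined by a window `KE ⊔ KV` of lattice edges and
vertices (cylinder decomposition). -/
theorem theta_eq_enhMeasure_real {KE : Finset (Sym2 (Site 3))} {KV : Finset (Site 3)}
    (hKE : ∀ e ∈ KE, e ∈ (zdGraph 3).edgeSet) (hdet : DeterminedBy A ↑(KE.disjSum KV))
    (p s : unitInterval) :
    AGLine.Theta KE KV A p s = (EnhProp42.enhMeasure (zdGraph 3) p s).real A := by
  classical
  rw [EnhProp42.enhMeasure, RussoPath.prodBernoulli_real_eq_sum_powerset hdet, AGLine.Theta,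
    ProdWeight.gTheta]
  refine Finset.sum_congr rfl fun S _ => ?_
  split_ifs
  · unfold ProdWeight.gW ProdWeight.gwt
    refine Finset.prod_congr rfl fun i hi => ?_
    have hpar : AGLine.par (p : ℝ) (s : ℝ) i = ((EnhProp42.enhParams (zdGraph 3) p s i : unitInterval) : ℝ) := by
      cases i with
      | inl e =>
        have he : e ∈ (zdGraph 3).edgeSet := hKE e (Finset.inl_mem_disjSum.1 hi)
        simp [AGLine.par, EnhProp42.enhParams, he]
      | inr v => simp [AGLine.par, EnhProp42.enhParams]
    rw [hpar]
    split_ifs <;> rfl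
  · rfl

/-- The exit event of a FIXED bond configuration modified by deleting `D`: measurable. -/
theorem measurableSet_far_deleted (D₀ : Set (Site 3)) (o : Site 3) (r : ℕ) :
    MeasurableSet {ω : Set (Sym2 (Site 3)) | ∃ v, (openGraph {e | e ∈ ω ∧ ∀ y ∈ e, y ∉ D₀}).Reachable o v ∧
      v - o ∉ box 3 r} := by
  have hmeas : Measurable fun ω : Set (Sym2 (Site 3)) => ({e | e ∈ ω ∧ ∀ y ∈ e, y ∉ D₀} : Set (Sym2 (Site 3))) :=
    measurable_set_iff.2 fun e => (measurable_set_mem e).and measurable_const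
  have : {ω : Set (Sym2 (Site 3)) | ∃ v, (openGraph {e | e ∈ ω ∧ ∀ y ∈ e, y ∉ D₀}).Reachable o v ∧
      v - o ∉ box 3 r} = ⋃ v : Site 3, (if v - o ∈ box 3 r then ∅ else
        (fun ω : Set (Sym2 (Site 3)) => ({e | e ∈ ω ∧ ∀ y ∈ e, y ∉ D₀} : Set (Sym2 (Site 3)))) ⁻¹' openConn o v) := by
    ext ω
    simp only [Set.mem_setOf_eq, Set.mem_iUnion]
    constructor
    · rintro ⟨v, hv, hvr⟩
      exact ⟨v, by rw [if_neg hvr]; exact hv⟩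
    · rintro ⟨v, hv⟩
      split_ifs at hv with h
      · simp at hv
      · exact ⟨v, hv, h⟩
  rw [this]
  refine MeasurableSet.iUnion fun v => ?_
  split_ifs
  · exact MeasurableSet.empty
  · exact hmeas (measurableSet_openConn_holds _ _)

/-- The exit event of a bond configuration: measurable. -/
theorem measurableSet_far (o : Site 3) (r : ℕ) :
    MeasurableSet {ω : Set (Sym2 (Site 3)) | ∃ v, (openGraph ω).Reachable o v ∧ v - o ∉ box 3 r} := by
  have : {ω : Set (Sym2 (Site 3)) | ∃ v, (openGraph ω).Reachable o v ∧ v - o ∉ box 3 r} =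
      ⋃ v : Site 3, (if v - o ∈ box 3 r then ∅ else openConn o v) := by
    ext ω
    simp only [Set.mem_setOf_eq, Set.mem_iUnion]
    constructor
    · rintro ⟨v, hv, hvr⟩
      exact ⟨v, by rw [if_neg hvr]; exact hv⟩
    · rintro ⟨v, hv⟩
      split_ifs at hv with h
      · simp at hv
      · exact ⟨v, hv, h⟩
  rw [this]
  refine MeasurableSet.iUnion fun v => ?_
  split_ifs
  · exact MeasurableSet.empty
  · exact measurableSet_openConn_holds _ _

/-- **Lower comparison.** For `D ⊆ D₀`, the probability that the `D₀`-deleted cluster of `o` is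
infinite under `P_p` is at most `ℙ_{p,s}(A)` for every `s` (an infinite cluster leaves every box, and
the deleted configuration uses no marks). -/
theorem measureReal_deleted_le_enhMeasure
    (hav : ∀ ξ f, f ∈ av ξ ↔ Sum.inl f ∈ ξ ∧ f ∈ (zdGraph 3).edgeSet ∧ ∀ y ∈ f, y ∈ D → Sum.inr y ∈ ξ)
    (hA : ∀ ξ, ξ ∈ A ↔ ∃ v, (openGraph (av ξ)).Reachable o v ∧ v - o ∉ box 3 r)
    {D₀ : Set (Site 3)} (hD : D ⊆ D₀) (p s : unitInterval) :
    (bondPercolation (zdGraph 3) p).real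
        {ω | (openCluster {e | e ∈ ω ∧ ∀ y ∈ e, y ∉ D₀} o).Infinite} ≤
      (EnhProp42.enhMeasure (zdGraph 3) p s).real A := by
  classical
  set far : Set (Set (Sym2 (Site 3))) := {ω | ∃ v, (openGraph {e | e ∈ ω ∧ ∀ y ∈ e, y ∉ D₀}).Reachable o v ∧
    v - o ∉ box 3 r} with hfar
  set good : Set (Set (Sym2 (Site 3))) := {ω | ω ⊆ (zdGraph 3).edgeSet} with hgood
  -- an infinite deleted cluster exits the box
  have hsub : {ω : Set (Sym2 (Site 3)) | (openCluster {e | e ∈ ω ∧ ∀ y ∈ e, y ∉ D₀} o).Infinite} ⊆ far := by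
    intro ω hω
    by_contra hnot
    simp only [hfar, Set.mem_setOf_eq, not_exists, not_and, not_not] at hnot
    refine hω (Set.Finite.subset (((box 3 r).image (· + o)).finite_toSet) fun v hv => ?_)
    rw [Finset.mem_coe, mem_image_add_box]
    exact hnot v hv
  -- the pullback of `far ∩ good` lies in `A`
  have hpre : enhOmega ⁻¹' (far ∩ good) ⊆ A := by
    rintro ξ ⟨⟨v, hv, hvr⟩, hωE⟩
    rw [hA]
    refine ⟨v, hv.mono ?_, hvr⟩
    refine SimpleGraph.fromEdgeSet_mono fun f hf => ?_
    rw [hav]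
    exact ⟨hf.1, hωE hf.1, fun y hy hyD => absurd (hD hyD) (hf.2 y hy)⟩
  -- `good` has full measure under the edge marginal
  have hmap := EnhProp42.enhMeasure_map_enhOmega (zdGraph 3) p s
  have hgood1 : (bondPercolation (zdGraph 3) p) goodᶜ = 0 := by
    have := ProbabilityTheory.setBernoulli_ae_subset (u := (zdGraph 3).edgeSet) (p := p)
    rw [Filter.Eventually, mem_ae_iff] at this
    exact this
  have hmeas_enh : Measurable (enhOmega : Set (Sym2 (Site 3) ⊕ Site 3) → Set (Sym2 (Site 3))) :=
    measurable_set_iff.2 fun e => measurable_set_mem _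
  have hgoodμ : (EnhProp42.enhMeasure (zdGraph 3) p s) (enhOmega ⁻¹' good)ᶜ = 0 := by
    rw [← Set.preimage_compl]
    refine le_antisymm ?_ bot_le
    calc (EnhProp42.enhMeasure (zdGraph 3) p s) (enhOmega ⁻¹' goodᶜ)
        ≤ ((EnhProp42.enhMeasure (zdGraph 3) p s).map enhOmega) goodᶜ := Measure.le_map_apply hmeas_enh.aemeasurable _
      _ = 0 := by rw [hmap]; exact hgood1
  calc (bondPercolation (zdGraph 3) p).real {ω | (openCluster {e | e ∈ ω ∧ ∀ y ∈ e, y ∉ D₀} o).Infinite}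
      ≤ (bondPercolation (zdGraph 3) p).real far := measureReal_mono hsub
    _ = (EnhProp42.enhMeasure (zdGraph 3) p s).real (enhOmega ⁻¹' far) := by
        rw [← hmap, map_measureReal_apply hmeas_enh (measurableSet_far_deleted D₀ o r)]
    _ = (EnhProp42.enhMeasure (zdGraph 3) p s).real (enhOmega ⁻¹' far ∩ enhOmega ⁻¹' good) := by
        rw [measureReal_def, measureReal_def, measure_inter_conull hgoodμ]
    _ ≤ (EnhProp42.enhMeasure (zdGraph 3) p s).real A :=
        measureReal_mono (by rw [← Set.preimage_inter]; exact hpre)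

/-- **Upper comparison.** `ℙ_{p,s}(A) ≤ P_p(the cluster of o leaves o + box r)` (forget the marks). -/
theorem enhMeasure_le_measureReal_far
    (hav : ∀ ξ f, f ∈ av ξ ↔ Sum.inl f ∈ ξ ∧ f ∈ (zdGraph 3).edgeSet ∧ ∀ y ∈ f, y ∈ D → Sum.inr y ∈ ξ)
    (hA : ∀ ξ, ξ ∈ A ↔ ∃ v, (openGraph (av ξ)).Reachable o v ∧ v - o ∉ box 3 r)
    (p s : unitInterval) :
    (EnhProp42.enhMeasure (zdGraph 3) p s).real A ≤
      (bondPercolation (zdGraph 3) p).real {ω | ∃ v, (openGraph ω).Reachable o v ∧ v - o ∉ box 3 r} := by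
  have hmeas_enh : Measurable (enhOmega : Set (Sym2 (Site 3) ⊕ Site 3) → Set (Sym2 (Site 3))) :=
    measurable_set_iff.2 fun e => measurable_set_mem _
  have hsub : A ⊆ enhOmega ⁻¹' {ω | ∃ v, (openGraph ω).Reachable o v ∧ v - o ∉ box 3 r} := by
    intro ξ hξ
    rw [hA] at hξ
    obtain ⟨v, hv, hvr⟩ := hξ
    exact ⟨v, reachable_openGraph_mono (fun f hf => ((hav ξ f).1 hf).1) hv, hvr⟩
  calc (EnhProp42.enhMeasure (zdGraph 3) p s).real A
      ≤ (EnhProp42.enhMeasure (zdGraph 3) p s).real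
          (enhOmega ⁻¹' {ω | ∃ v, (openGraph ω).Reachable o v ∧ v - o ∉ box 3 r}) := measureReal_mono hsub
    _ = (bondPercolation (zdGraph 3) p).real {ω | ∃ v, (openGraph ω).Reachable o v ∧ v - o ∉ box 3 r} := by
        rw [← EnhProp42.enhMeasure_map_enhOmega (zdGraph 3) p s,
          map_measureReal_apply hmeas_enh (measurableSet_far o r)]

/-- **The limit `L → ∞`.** If `θ_o(p) = 0`, a number below `P_p(the cluster of o leaves o + box (r L))`
for all `L`, along radii `r L ≥ L`, is `≤ 0` (continuity from above: the events decrease to a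
sub-event of `{|C(o)| = ∞}`). -/
theorem le_zero_of_le_measureReal_far {p : unitInterval} (hθ : theta (zdGraph 3) o p = 0)
    {rad : ℕ → ℕ} (hmono : Monotone rad) (hrad : ∀ L, L ≤ rad L) {q : ℝ}
    (hq : ∀ L, q ≤ (bondPercolation (zdGraph 3) p).real
      {ω | ∃ v, (openGraph ω).Reachable o v ∧ v - o ∉ box 3 (rad L)}) : q ≤ 0 := by
  set μ := bondPercolation (zdGraph 3) p with hμ
  set s : ℕ → Set (Set (Sym2 (Site 3))) := fun L =>
    {ω | ∃ v, (openGraph ω).Reachable o v ∧ v - o ∉ box 3 (rad L)} with hs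
  have hanti : Antitone s := by
    intro L L' hLL' ω ⟨v, hv, hvr⟩
    exact ⟨v, hv, fun h => hvr (box_mono 3 (hmono hLL') h)⟩
  have hiInter : μ (⋂ L, s L) = ⨅ L, μ (s L) :=
    hanti.measure_iInter (fun L => (measurableSet_far o (rad L)).nullMeasurableSet) ⟨0, measure_ne_top _ _⟩
  have hsub : (⋂ L, s L) ⊆ percolatesAt o := by
    intro ω hω
    rw [Set.mem_iInter] at hω
    by_contra hfin
    have hfin' : (openCluster ω o).Finite := Set.not_infinite.1 hfin
    -- a finite cluster lies in some box
    obtain ⟨M, hM⟩ : ∃ M : ℕ, ∀ v ∈ openCluster ω o, v - o ∈ box 3 M := by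
      obtain ⟨t, ht⟩ := hfin'.exists_finset_coe
      classical
      refine ⟨t.sup fun v => Finset.univ.sup fun i => (v i - o i).natAbs, fun v hv => ?_⟩
      have hv' : v ∈ t := by rw [← Finset.mem_coe, ht]; exact hv
      rw [sub_mem_box_iff]
      intro i
      have h1 : (v i - o i).natAbs ≤ Finset.univ.sup fun i => (v i - o i).natAbs :=
        Finset.le_sup (f := fun i => (v i - o i).natAbs) (Finset.mem_univ i)
      have h2 : (Finset.univ.sup fun i => (v i - o i).natAbs) ≤
          t.sup fun v => Finset.univ.sup fun i => (v i - o i).natAbs :=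
        Finset.le_sup (f := fun v => Finset.univ.sup fun i => (v i - o i).natAbs) hv'
      omega
    obtain ⟨v, hv, hvr⟩ := hω M
    exact hvr (box_mono 3 (hrad M) (hM v hv))
  have hzero : μ (percolatesAt o) = 0 := by
    have : μ.real (percolatesAt o) = 0 := hθ
    exact (measureReal_eq_zero_iff (measure_ne_top _ _)).1 this
  have hle : ENNReal.ofReal q ≤ 0 := by
    calc ENNReal.ofReal q ≤ ⨅ L, μ (s L) := le_iInf fun L => by
            rw [← ofReal_measureReal (measure_ne_top _ _)]
            exact ENNReal.ofReal_le_ofReal (hq L)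
      _ = μ (⋂ L, s L) := hiInter.symm
      _ ≤ μ (percolatesAt o) := measure_mono hsub
      _ = 0 := hzero
  exact ENNReal.ofReal_eq_zero.1 (le_antisymm hle bot_le)


end Measure

end UnifDim

end Summit.CriticalPhenomena.PercolationContinuityZ3.Theorems
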